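import Literature.Topology.FourManifolds.BalancedPresentationMoves
import HarnessLib

/-!
# Andrews–Curtis triviality is insensitive to changes of the free basis

The tree's Andrews–Curtis relation `Literature.Topology.FourManifolds.IsAndrewsCurtisEquivalent`
(`BalancedPresentation.lean`) is generated by the three relator moves of Andrews–Curtis (1965).
Many formulations of the Andrews–Curtis conjecture also allow a change of the free basis (an
automorphism of the free group applied to all relators simultaneously) and permutations of the
relators; e.g. Gompf–Scharlemann–Thompson (2010), §7: the basis of `π₁(#ₙ S¹ × S²)` read off a
framed link "is unique up to Nielsen moves … Changing our choices in the construction changes the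
presentation by Andrews-Curtis moves". This file PROVES that Andrews–Curtis *triviality*
(equivalence to the trivial presentation `⟨x₁, …, xₙ ∣ x₁, …, xₙ⟩`) is the same for the extended
calculus whose basis changes are the elementary Nielsen automorphisms (`xₖ ↦ xₖ⁻¹`, `xₖ ↦ xₖ xₗ`,
renamings of the generators), and — GIVEN Nielsen's theorem that these generate `Aut Fₙ`
(Nielsen 1924; Johnson (1997), Ch. 3 §4, Cor. 7), vendored as the named fact
`autFreeGroup_eq_closure_nielsen` — for arbitrary automorphisms.

## Main results

* `nielsenInv k`, `nielsenMul k l h` — the elementary Nielsen automorphisms as `MulEquiv`s, and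
  `isAndrewsCurtisEquivalent_nielsenInv_comp_trivial`, `…_nielsenMul_…`, `…_nielsenMul_symm_…`,
  `…_freeGroupCongr_…`: they carry the trivial presentation to an Andrews–Curtis trivial one;
* `ExtAndrewsCurtisMove`, `IsExtAndrewsCurtisEquivalent` — the extended calculus (relator moves,
  relator permutations, elementary basis changes, generator renamings) and
  `isExtAndrewsCurtisEquivalent_trivial_iff`: **extended-AC-trivial iff AC-trivial** (proved);
* `autFreeGroup_eq_closure_nielsen` (named fact) and, from it,
  `isAndrewsCurtisEquivalent_mulAut_comp_trivial_iff`: Andrews–Curtis triviality is invariant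
  under every automorphism of the free group applied to all relators.

Consumer: the barrier `Literature/Barriers/SmoothPoincare4/PropertyTwoRAndrewsCurtis.lean` (its
scope caveat on the choice of Andrews–Curtis moves).

## References

* J. J. Andrews, M. L. Curtis, *Free groups and handlebodies*, Proc. AMS 16 (1965) 192–195.
  [AndrewsCurtis1965]
* D. L. Johnson, *Presentations of Groups*, 2nd ed., LMS Student Texts 15, CUP (1997), Ch. 3
  (Nielsen's method): §1 Def. 1 (elementary Nielsen transformations (T1) `uᵢ ↦ uᵢ⁻¹`,
  (T2) `uᵢ ↦ uᵢuⱼ`), §4 Cor. 7 and the paragraph before it ("These `r²` transformations thus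
  generate `Aut F`"). [Johnson1997]
* R. E. Gompf, M. Scharlemann, A. Thompson, Geom. Topol. 14 (2010), §7. [GompfScharlemannThompson2010]
-/

noncomputable section

open Function

namespace Literature.Topology.FourManifolds

variable {n : ℕ}

/-! ### Elementary Nielsen automorphisms (changes of free basis) -/

/-- The endomorphism `xₖ ↦ xₖ⁻¹`, `xⱼ ↦ xⱼ` (`j ≠ k`) of the free group (Johnson (1997), Ch. 3 §1,
transformation (T1) on the basis). [cite: Johnson1997, Ch. 3 §1 Def. 1 (T1)] -/
def nielsenInvHom (k : Fin n) : FreeGroup (Fin n) →* FreeGroup (Fin n) :=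
  FreeGroup.lift (update FreeGroup.of k (FreeGroup.of k)⁻¹)

/-- `nielsenInvHom k` inverts `xₖ`. [folklore] -/
@[simp] theorem nielsenInvHom_of_self (k : Fin n) :
    nielsenInvHom k (FreeGroup.of k) = (FreeGroup.of k)⁻¹ := by
  simp [nielsenInvHom]

/-- `nielsenInvHom k` fixes the other generators. [folklore] -/
@[simp] theorem nielsenInvHom_of_ne {k j : Fin n} (h : j ≠ k) :
    nielsenInvHom k (FreeGroup.of j) = FreeGroup.of j := by
  simp [nielsenInvHom, update_of_ne h]

/-- `xₖ ↦ xₖ⁻¹` is an involution. [folklore] -/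
theorem nielsenInvHom_comp_self (k : Fin n) :
    (nielsenInvHom k).comp (nielsenInvHom k) = MonoidHom.id _ := by
  ext j
  rcases eq_or_ne j k with rfl | h
  · simp
  · simp [h]

/-- **The elementary Nielsen automorphism `xₖ ↦ xₖ⁻¹`** of the free group on `x₀, …, xₙ₋₁`
(Johnson (1997), Ch. 3 §1 (T1), §4). [cite: Johnson1997, Ch. 3 §1 Def. 1 (T1)] -/
def nielsenInv (k : Fin n) : FreeGroup (Fin n) ≃* FreeGroup (Fin n) :=
  (nielsenInvHom k).toMulEquiv (nielsenInvHom k) (nielsenInvHom_comp_self k)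
    (nielsenInvHom_comp_self k)

/-- Underlying function of `nielsenInv k`. [folklore] -/
@[simp] theorem coe_nielsenInv (k : Fin n) : ⇑(nielsenInv k) = ⇑(nielsenInvHom k) := rfl

/-- `nielsenInv k` is its own inverse. [folklore] -/
@[simp] theorem nielsenInv_symm (k : Fin n) : (nielsenInv k).symm = nielsenInv k := rfl

/-- The endomorphism `xₖ ↦ xₖ xₗ`, `xⱼ ↦ xⱼ` (`j ≠ k`) (Johnson (1997), Ch. 3 §1, (T2)).
[cite: Johnson1997, Ch. 3 §1 Def. 1 (T2)] -/
def nielsenMulHom (k l : Fin n) : FreeGroup (Fin n) →* FreeGroup (Fin n) :=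
  FreeGroup.lift (update FreeGroup.of k (FreeGroup.of k * FreeGroup.of l))

/-- The endomorphism `xₖ ↦ xₖ xₗ⁻¹`, `xⱼ ↦ xⱼ` (`j ≠ k`), inverse to `nielsenMulHom k l` when
`k ≠ l`. [folklore] -/
def nielsenMulInvHom (k l : Fin n) : FreeGroup (Fin n) →* FreeGroup (Fin n) :=
  FreeGroup.lift (update FreeGroup.of k (FreeGroup.of k * (FreeGroup.of l)⁻¹))

/-- `nielsenMulHom k l` on `xₖ`. [folklore] -/
@[simp] theorem nielsenMulHom_of_self (k l : Fin n) :
    nielsenMulHom k l (FreeGroup.of k) = FreeGroup.of k * FreeGroup.of l := by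
  simp [nielsenMulHom]

/-- `nielsenMulHom k l` fixes the other generators. [folklore] -/
@[simp] theorem nielsenMulHom_of_ne {k l j : Fin n} (h : j ≠ k) :
    nielsenMulHom k l (FreeGroup.of j) = FreeGroup.of j := by
  simp [nielsenMulHom, update_of_ne h]

/-- `nielsenMulInvHom k l` on `xₖ`. [folklore] -/
@[simp] theorem nielsenMulInvHom_of_self (k l : Fin n) :
    nielsenMulInvHom k l (FreeGroup.of k) = FreeGroup.of k * (FreeGroup.of l)⁻¹ := by
  simp [nielsenMulInvHom]

/-- `nielsenMulInvHom k l` fixes the other generators. [folklore] -/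
@[simp] theorem nielsenMulInvHom_of_ne {k l j : Fin n} (h : j ≠ k) :
    nielsenMulInvHom k l (FreeGroup.of j) = FreeGroup.of j := by
  simp [nielsenMulInvHom, update_of_ne h]

/-- `xₖ ↦ xₖ xₗ⁻¹` after `xₖ ↦ xₖ xₗ` is the identity (`k ≠ l`). [folklore] -/
theorem nielsenMulInvHom_comp_nielsenMulHom {k l : Fin n} (hkl : k ≠ l) :
    (nielsenMulInvHom k l).comp (nielsenMulHom k l) = MonoidHom.id _ := by
  ext j
  rcases eq_or_ne j k with rfl | h
  · simp [map_mul, nielsenMulInvHom_of_ne hkl.symm]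
  · simp [h]

/-- `xₖ ↦ xₖ xₗ` after `xₖ ↦ xₖ xₗ⁻¹` is the identity (`k ≠ l`). [folklore] -/
theorem nielsenMulHom_comp_nielsenMulInvHom {k l : Fin n} (hkl : k ≠ l) :
    (nielsenMulHom k l).comp (nielsenMulInvHom k l) = MonoidHom.id _ := by
  ext j
  rcases eq_or_ne j k with rfl | h
  · simp [map_mul, map_inv, nielsenMulHom_of_ne hkl.symm]
  · simp [h]

/-- **The elementary Nielsen automorphism `xₖ ↦ xₖ xₗ`** (`k ≠ l`) of the free group on
`x₀, …, xₙ₋₁` (Johnson (1997), Ch. 3 §1 (T2), §4). [cite: Johnson1997, Ch. 3 §1 Def. 1 (T2)] -/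
def nielsenMul (k l : Fin n) (hkl : k ≠ l) : FreeGroup (Fin n) ≃* FreeGroup (Fin n) :=
  (nielsenMulHom k l).toMulEquiv (nielsenMulInvHom k l) (nielsenMulInvHom_comp_nielsenMulHom hkl)
    (nielsenMulHom_comp_nielsenMulInvHom hkl)

/-- Underlying function of `nielsenMul k l h`. [folklore] -/
@[simp] theorem coe_nielsenMul {k l : Fin n} (hkl : k ≠ l) :
    ⇑(nielsenMul k l hkl) = ⇑(nielsenMulHom k l) := rfl

/-- Underlying function of the inverse of `nielsenMul k l h`. [folklore] -/
@[simp] theorem coe_nielsenMul_symm {k l : Fin n} (hkl : k ≠ l) :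
    ⇑(nielsenMul k l hkl).symm = ⇑(nielsenMulInvHom k l) := rfl

/-! ### The elementary basis changes preserve Andrews–Curtis triviality -/

open BalancedPresentation in
/-- `xₖ ↦ xₖ⁻¹` carries the trivial presentation to `(x₀, …, xₖ⁻¹, …)`, one move away from it.
[folklore] -/
theorem isAndrewsCurtisEquivalent_nielsenInv_comp_trivial (k : Fin n) :
    IsAndrewsCurtisEquivalent (⇑(nielsenInv k) ∘ trivial n) (trivial n) := by
  have e : ⇑(nielsenInv k) ∘ trivial n = update (trivial n) k (trivial n k)⁻¹ := by
    funext j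
    rcases eq_or_ne j k with rfl | h
    · simp [BalancedPresentation.trivial]
    · simp [BalancedPresentation.trivial, h]
  rw [e]
  exact (IsAndrewsCurtisEquivalent.update_inv _ _).symm

open BalancedPresentation in
/-- `xₖ ↦ xₖ xₗ` carries the trivial presentation to `(x₀, …, xₖxₗ, …)`, one move away from it.
[folklore] -/
theorem isAndrewsCurtisEquivalent_nielsenMul_comp_trivial {k l : Fin n} (hkl : k ≠ l) :
    IsAndrewsCurtisEquivalent (⇑(nielsenMul k l hkl) ∘ trivial n) (trivial n) := by
  have e : ⇑(nielsenMul k l hkl) ∘ trivial n = update (trivial n) k (trivial n k * trivial n l) := by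
    funext j
    rcases eq_or_ne j k with rfl | h
    · simp [BalancedPresentation.trivial]
    · simp [BalancedPresentation.trivial, h]
  rw [e]
  exact (IsAndrewsCurtisEquivalent.update_mul _ hkl).symm

open BalancedPresentation in
/-- `xₖ ↦ xₖ xₗ⁻¹` carries the trivial presentation to `(x₀, …, xₖxₗ⁻¹, …)`, three moves away
from it (invert `xₗ`, multiply, invert back). [folklore] -/
theorem isAndrewsCurtisEquivalent_nielsenMul_symm_comp_trivial {k l : Fin n} (hkl : k ≠ l) :
    IsAndrewsCurtisEquivalent (⇑(nielsenMul k l hkl).symm ∘ trivial n) (trivial n) := by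
  have e : ⇑(nielsenMul k l hkl).symm ∘ trivial n =
      update (update (trivial n) k (trivial n k * (trivial n l)⁻¹)) l (trivial n l) := by
    rw [update₂_eq_update _ hkl]
    funext j
    rcases eq_or_ne j k with rfl | h
    · simp [BalancedPresentation.trivial]
    · simp [BalancedPresentation.trivial, h]
  rw [e]
  refine IsAndrewsCurtisEquivalent.symm ?_
  conv_lhs => rw [← update₂_eq_self (a := k) (b := l) (trivial n)]
  refine (IsAndrewsCurtisEquivalent.update₂_inv_right _ _ _).trans ?_
  refine (IsAndrewsCurtisEquivalent.update₂_mul_left _ hkl _ _).trans ?_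
  simpa using IsAndrewsCurtisEquivalent.update₂_inv_right (a := k) (b := l) (trivial n)
    (trivial n k * (trivial n l)⁻¹) (trivial n l)⁻¹

open BalancedPresentation in
/-- Renaming the generators along a permutation `σ` carries the trivial presentation to a
permutation of itself. [folklore] -/
theorem isAndrewsCurtisEquivalent_freeGroupCongr_comp_trivial (σ : Equiv.Perm (Fin n)) :
    IsAndrewsCurtisEquivalent (⇑(FreeGroup.freeGroupCongr σ) ∘ trivial n) (trivial n) := by
  have e : ⇑(FreeGroup.freeGroupCongr σ) ∘ trivial n = trivial n ∘ ⇑σ := by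
    funext j
    simp [BalancedPresentation.trivial, FreeGroup.freeGroupCongr]
  rw [e]
  exact (IsAndrewsCurtisEquivalent.comp_perm _ σ).symm

/-- A free-group automorphism whose INVERSE fixes Andrews–Curtis triviality of the trivial
presentation reflects Andrews–Curtis triviality. [folklore] -/
theorem isAndrewsCurtisEquivalent_trivial_of_mulEquiv_comp
    (e : FreeGroup (Fin n) ≃* FreeGroup (Fin n))
    (he : IsAndrewsCurtisEquivalent (⇑e.symm ∘ BalancedPresentation.trivial n)
      (BalancedPresentation.trivial n))
    {P : BalancedPresentation n}
    (h : IsAndrewsCurtisEquivalent (⇑e ∘ P) (BalancedPresentation.trivial n)) :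
    IsAndrewsCurtisEquivalent P (BalancedPresentation.trivial n) := by
  have h' := IsAndrewsCurtisEquivalent.comp_of_trivial e.symm he h
  have hP : ⇑e.symm ∘ (⇑e ∘ P) = P := by
    funext i
    simp
  rwa [hP] at h'

/-! ### The extended calculus and the main theorem -/

/-- The **extended Andrews–Curtis moves** on balanced presentations: the three moves of
`AndrewsCurtisMove` together with
* `perm σ`: permuting the relators, `(rᵢ) ↦ (r_{σ i})`;
* `basisInv k`: the change of free basis `xₖ ↦ xₖ⁻¹` applied to every relator;
* `basisMul k l`: the change of free basis `xₖ ↦ xₖ xₗ` (`k ≠ l`) applied to every relator;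
* `rename σ`: renaming the generators along a permutation `σ`.
The basis changes are the elementary Nielsen transformations of the generators (Johnson (1997),
Ch. 3 §1 (T1), (T2)); "transformations of the generators" accompany the relator moves in many
formulations of the Andrews–Curtis conjecture, e.g. Gompf–Scharlemann–Thompson (2010), §7 ("basis
… unique up to Nielsen moves"). [cite: GompfScharlemannThompson2010, §7] -/
inductive ExtAndrewsCurtisMove : BalancedPresentation n → BalancedPresentation n → Prop
  /-- One of the three Andrews–Curtis relator moves. -/
  | ac {P Q : BalancedPresentation n} (h : AndrewsCurtisMove P Q) : ExtAndrewsCurtisMove P Q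
  /-- Permuting the relators. -/
  | perm (P : BalancedPresentation n) (σ : Equiv.Perm (Fin n)) :
      ExtAndrewsCurtisMove P (P ∘ ⇑σ)
  /-- The basis change `xₖ ↦ xₖ⁻¹` in every relator. -/
  | basisInv (P : BalancedPresentation n) (k : Fin n) :
      ExtAndrewsCurtisMove P (⇑(nielsenInv k) ∘ P)
  /-- The basis change `xₖ ↦ xₖ xₗ` (`k ≠ l`) in every relator. -/
  | basisMul (P : BalancedPresentation n) (k l : Fin n) (hkl : k ≠ l) :
      ExtAndrewsCurtisMove P (⇑(nielsenMul k l hkl) ∘ P)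
  /-- Renaming the generators along `σ` in every relator. -/
  | rename (P : BalancedPresentation n) (σ : Equiv.Perm (Fin n)) :
      ExtAndrewsCurtisMove P (⇑(FreeGroup.freeGroupCongr σ) ∘ P)

/-- **Extended Andrews–Curtis equivalence**: the equivalence relation generated by the extended
moves (relator moves, relator permutations, elementary basis changes, generator renamings).
[cite: GompfScharlemannThompson2010, §7] -/
def IsExtAndrewsCurtisEquivalent : BalancedPresentation n → BalancedPresentation n → Prop :=
  Relation.EqvGen ExtAndrewsCurtisMove

/-- Andrews–Curtis equivalent presentations are extended-equivalent. [folklore] -/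
theorem IsAndrewsCurtisEquivalent.isExtAndrewsCurtisEquivalent {P Q : BalancedPresentation n}
    (h : IsAndrewsCurtisEquivalent P Q) : IsExtAndrewsCurtisEquivalent P Q :=
  Relation.EqvGen.mono (fun _ _ h ↦ ExtAndrewsCurtisMove.ac h) P Q h

open BalancedPresentation in
/-- One extended move does not change Andrews–Curtis triviality (in the tree's restricted
sense). [folklore] -/
theorem ExtAndrewsCurtisMove.isAndrewsCurtisEquivalent_trivial_iff {P Q : BalancedPresentation n}
    (h : ExtAndrewsCurtisMove P Q) :
    IsAndrewsCurtisEquivalent P (trivial n) ↔ IsAndrewsCurtisEquivalent Q (trivial n) := by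
  cases h with
  | ac h =>
    exact ⟨fun hP ↦ h.isAndrewsCurtisEquivalent.symm.trans hP,
      fun hQ ↦ h.isAndrewsCurtisEquivalent.trans hQ⟩
  | perm σ =>
    exact ⟨fun hP ↦ (IsAndrewsCurtisEquivalent.comp_perm P σ).symm.trans hP,
      fun hQ ↦ (IsAndrewsCurtisEquivalent.comp_perm P σ).trans hQ⟩
  | basisInv k =>
    refine ⟨IsAndrewsCurtisEquivalent.comp_of_trivial (nielsenInv k)
      (isAndrewsCurtisEquivalent_nielsenInv_comp_trivial k), fun hQ ↦ ?_⟩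
    refine isAndrewsCurtisEquivalent_trivial_of_mulEquiv_comp (nielsenInv k) ?_ hQ
    rw [nielsenInv_symm]
    exact isAndrewsCurtisEquivalent_nielsenInv_comp_trivial k
  | basisMul k l hkl =>
    exact ⟨IsAndrewsCurtisEquivalent.comp_of_trivial (nielsenMul k l hkl)
      (isAndrewsCurtisEquivalent_nielsenMul_comp_trivial hkl),
      isAndrewsCurtisEquivalent_trivial_of_mulEquiv_comp (nielsenMul k l hkl)
        (isAndrewsCurtisEquivalent_nielsenMul_symm_comp_trivial hkl)⟩
  | rename σ =>
    refine ⟨IsAndrewsCurtisEquivalent.comp_of_trivial (FreeGroup.freeGroupCongr σ)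
      (isAndrewsCurtisEquivalent_freeGroupCongr_comp_trivial σ), fun hQ ↦ ?_⟩
    refine isAndrewsCurtisEquivalent_trivial_of_mulEquiv_comp (FreeGroup.freeGroupCongr σ) ?_ hQ
    rw [FreeGroup.freeGroupCongr_symm]
    exact isAndrewsCurtisEquivalent_freeGroupCongr_comp_trivial σ.symm

open BalancedPresentation in
/-- Extended-equivalent presentations are Andrews–Curtis trivial simultaneously. [folklore] -/
theorem IsExtAndrewsCurtisEquivalent.isAndrewsCurtisEquivalent_trivial_iff
    {P Q : BalancedPresentation n} (h : IsExtAndrewsCurtisEquivalent P Q) :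
    IsAndrewsCurtisEquivalent P (trivial n) ↔ IsAndrewsCurtisEquivalent Q (trivial n) := by
  induction h with
  | rel _ _ h => exact h.isAndrewsCurtisEquivalent_trivial_iff
  | refl _ => exact Iff.rfl
  | symm _ _ _ ih => exact ih.symm
  | trans _ _ _ _ _ ih₁ ih₂ => exact ih₁.trans ih₂

open BalancedPresentation in
/-- **Main theorem: extended Andrews–Curtis triviality is Andrews–Curtis triviality.** A balanced
presentation can be reduced to the trivial presentation by relator moves, relator permutations,
elementary changes of basis and renamings of generators iff it can be reduced by the three
relator moves of `AndrewsCurtisMove` alone. [folklore] -/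
theorem isExtAndrewsCurtisEquivalent_trivial_iff (P : BalancedPresentation n) :
    IsExtAndrewsCurtisEquivalent P (trivial n) ↔ IsAndrewsCurtisEquivalent P (trivial n) :=
  ⟨fun h ↦ h.isAndrewsCurtisEquivalent_trivial_iff.2 (IsAndrewsCurtisEquivalent.refl _),
    IsAndrewsCurtisEquivalent.isExtAndrewsCurtisEquivalent⟩

/-! ### Arbitrary changes of basis, given Nielsen's theorem -/

/-- **Nielsen's theorem (named fact).** For `r < ∞` the automorphism group of the free group
`F(x₀, …, x_{r-1})` is generated by the `r²` elementary Nielsen automorphisms `xₖ ↦ xₖ⁻¹`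
(`r` of them) and `xₖ ↦ xₖ xₗ`, `l ≠ k` (`r(r-1)` of them): Johnson (1997), Ch. 3 §4, the
paragraph before Cor. 7 ("These `r²` transformations thus generate `Aut F`") and Cor. 7 ("If `F`
is a finitely-generated free group, then `Aut F` is finitely generated"); originally Nielsen,
Math. Ann. 91 (1924). Stated in `MulAut (FreeGroup (Fin n))`. Not in Mathlib (which has
Nielsen–Schreier, not Nielsen's generation theorem); users take `(h : autFreeGroup_eq_closure_nielsen)`.
[cite: Johnson1997, Ch. 3 §4 Cor. 7] -/
def autFreeGroup_eq_closure_nielsen : Prop :=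
  ∀ n : ℕ, Subgroup.closure
      (Set.range (fun k : Fin n ↦ nielsenInv k) ∪
        {e | ∃ (k l : Fin n) (hkl : k ≠ l), e = nielsenMul k l hkl}) =
    (⊤ : Subgroup (MulAut (FreeGroup (Fin n))))

open BalancedPresentation in
/-- **Given Nielsen's theorem, Andrews–Curtis triviality is invariant under every change of free
basis**: for any automorphism `φ` of the free group, `(φ rᵢ)ᵢ` is Andrews–Curtis trivial iff
`(rᵢ)ᵢ` is. [folklore] -/
theorem isAndrewsCurtisEquivalent_mulAut_comp_trivial_iff (hN : autFreeGroup_eq_closure_nielsen)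
    (φ : MulAut (FreeGroup (Fin n))) (P : BalancedPresentation n) :
    IsAndrewsCurtisEquivalent (⇑φ ∘ P) (trivial n) ↔ IsAndrewsCurtisEquivalent P (trivial n) := by
  have hφ : φ ∈ Subgroup.closure (Set.range (fun k : Fin n ↦ nielsenInv k) ∪
      {e | ∃ (k l : Fin n) (hkl : k ≠ l), e = nielsenMul k l hkl}) := by
    rw [hN n]
    exact Subgroup.mem_top φ
  induction hφ using Subgroup.closure_induction generalizing P with
  | mem e he =>
    rcases he with ⟨k, rfl⟩ | ⟨k, l, hkl, rfl⟩
    · exact ((ExtAndrewsCurtisMove.basisInv P k).isAndrewsCurtisEquivalent_trivial_iff).symm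
    · exact ((ExtAndrewsCurtisMove.basisMul P k l hkl).isAndrewsCurtisEquivalent_trivial_iff).symm
  | one => simp
  | mul e f _ _ ihe ihf =>
    rw [MulAut.coe_mul, Function.comp_assoc]
    exact (ihe _).trans (ihf P)
  | inv e _ ih =>
    have h := ih (⇑e⁻¹ ∘ P)
    have hP : ⇑e ∘ (⇑e⁻¹ ∘ P) = P := by
      funext i
      simp [MulAut.inv_def]
    rw [hP] at h
    exact h.symm

end Literature.Topology.FourManifolds

end
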